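import Summits.CriticalPhenomena.PercolationContinuityZ3.Theorems.Transplant.FKConnectivityAllQDefs
import Summits.CriticalPhenomena.PercolationContinuityZ3.Theorems.Transplant.FKConnectivityAllQSPGluing
import Literature.Probability.Percolation.TwoSetConditionalAssociationRC
import HarnessLib

/-!
# The arboreal gas (weighted spanning-forest measure) as the `q ↓ 0` limit of `φ_{𝐩,q}` along `p_e = w_e q/(1 − w_e + w_e q)`:
# DEFINITIONS — forest configurations, the arboreal-gas measure with edge parameters, the arboreal curve, and the node
# `ArborealHubPos` (Ayyer–Linusson–Ravichandran's Conjecture 7.1)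

Definitions file (`--supports stmt-CriticalPhenomena-4575`), FK sub-lane `prim-bschramm-fk-1` (gen 9) of the post-continuity
programme; builds on p205010 (kernel theorem, internal audit signed; external expert review pending).  Definitions + their
elementary API; one `@[conjecture]` node — NOT asserted; no sorries; standard axioms.

* `IsForestCfg ω` — the open pairs of `ω` are loop-free and the open graph is acyclic (a spanning forest of the complete graph).
* `agWeight w ω = 1{ω forest}·∏_e w_e^{ω(e)}(1 − w_e)^{1−ω(e)}`, `agPartition w`, `agMass w ω`, `agMeasure w` — **the arboreal gas with
  edge parameters** `w : Sym2 V → [0,1]`: product measure `P_w` CONDITIONED on the configuration being a forest; for the edge set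
  of a graph `G` with `w ≡ λ/(1+λ)` on `E(G)` and `0` elsewhere this is the arboreal gas `μ^F_{G,λ}(F) ∝ λ^{|F|}` of
  Ayyer–Linusson–Ravichandran / Bauerschmidt–Crawford–Helmuth–Swan, i.e. Grimmett's weighted-forest limit measure `φ^for_α`
  (Grimmett 2006, §1.5 eq. (1.22): `φ_{p,q} ⇒ φ^for_α` as `q ↓ 0` with `p = αq`).
* `agParams w q` — the random-cluster edge parameters `p_e(q) = w_e q/(1 − w_e + w_e q)` on the ARBOREAL CURVE (the ratio
  `p_e/(q(1 − p_e)) = w_e/(1 − w_e)` is constant in `q`; Grimmett's `p = αq` to first order); the companion file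
  `…ArborealLimit.lean` proves `φ_{agParams w q, q}(E) → agMeasure w (E)` as `q ↓ 0`.
* `ArborealHubPos` — **ALR Conjecture 7.1** (`μ^F(u ↔ a, a ↔ v) ≥ μ^F(u ↔ a)·μ^F(a ↔ v)`) for every finite weighted graph, in the
  tree's vocabulary `FK.HubUnder (agMeasure w) u a v`.  CONJECTURE-SHAPED, NOT asserted; the companion `…ArborealHub.lean` derives
  it from the random-cluster node `FK.HubFKPos` (hence from `FK.ClusterDomAdjFKPos`) and proves it outright on 2-tree supports.
[cite: Grimmett2006, §1.5 eq. (1.22), Thm. (1.23) (pp. 13–14)] [cite: AyyerLinussonRavichandran2025, §1 p. 3 (μ^F_{G,λ}); §7 eq. (15), Conj. 7.1 (p. 22)]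
-/

noncomputable section

namespace Summit.CriticalPhenomena.PercolationContinuityZ3.Theorems

namespace FK

open MeasureTheory Set Literature.Probability.LatticeModels Literature.Probability.Percolation
open scoped Classical
open BHK2006 DecisionTree

variable {V : Type*}

/-! ### Forest configurations and the arboreal gas -/

/-- A bond configuration is a **forest configuration** if it contains no loop pair and its open graph is acyclic (Grimmett's
`Ω_for`, the spanning forests of the complete graph on `V`). [cite: Grimmett2006, §1.5 eq. (1.22) (p. 13)] -/
def IsForestCfg (ω : BondConfig V) : Prop := (∀ e ∈ ω, ¬ e.IsDiag) ∧ (openGraph ω).IsAcyclic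

/-- The empty configuration is a forest. [folklore] -/
theorem isForestCfg_empty : IsForestCfg (∅ : BondConfig V) := by
  refine ⟨fun e he => he.elim, ?_⟩
  have h : openGraph (∅ : BondConfig V) = ⊥ := by
    ext a b; simp [openGraph]
  rw [h]; exact SimpleGraph.isAcyclic_bot

variable [Fintype V]

/-- **Arboreal-gas weight** with edge parameters `w`: the product-measure weight `∏_e w_e^{ω(e)}(1−w_e)^{1−ω(e)}` restricted to forest
configurations. [cite: Grimmett2006, §1.5 eq. (1.22) (p. 13)] [cite: AyyerLinussonRavichandran2025, §1 p. 3] -/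
def agWeight (w : Sym2 V → unitInterval) (ω : BondConfig V) : ℝ :=
  if IsForestCfg ω then weight (fun e => (w e : ℝ)) ω else 0

/-- The arboreal-gas partition function `Z_for = Σ_{ω forest} ∏ …`. [cite: Grimmett2006, §1.5 eq. (1.22) (p. 13)] -/
def agPartition (w : Sym2 V → unitInterval) : ℝ := ∑ ω : BondConfig V, agWeight w ω

/-- The arboreal-gas point mass `agWeight w ω / Z_for` (junk value `0` when `Z_for = 0`, i.e. when the parameter-1 pairs contain a
cycle or a loop). [cite: Grimmett2006, §1.5 eq. (1.22) (p. 13)] -/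
def agMass (w : Sym2 V → unitInterval) (ω : BondConfig V) : ℝ := agWeight w ω / agPartition w

/-- **The arboreal gas with edge parameters `w`** (weighted spanning-forest measure; product measure conditioned on acyclicity) as a
finite sum of Dirac masses on bond configurations. [cite: Grimmett2006, §1.5 eq. (1.22), Thm. (1.23) (pp. 13–14)]
[cite: AyyerLinussonRavichandran2025, §1 p. 3 (μ^F_{G,λ})] -/
def agMeasure (w : Sym2 V → unitInterval) : Measure (BondConfig V) :=
  ∑ ω : BondConfig V, ENNReal.ofReal (agMass w ω) • Measure.dirac ω

/-- **The arboreal curve**: random-cluster edge parameters `p_e(q) = w_e q / (1 − w_e + w_e q)` (clamped to `[0,1]`, which is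
inactive for `q > 0`), along which `p_e/(q(1 − p_e)) = w_e/(1 − w_e)` is constant. [cite: Grimmett2006, §1.5 (p = αq), Thm. (1.23) (pp. 13–14)] -/
def agParams (w : Sym2 V → unitInterval) (q : ℝ) : Sym2 V → unitInterval :=
  fun e => Set.projIcc (0 : ℝ) 1 zero_le_one ((w e : ℝ) * q / (1 - (w e : ℝ) + (w e : ℝ) * q))

/-! ### Elementary API -/

variable (w : Sym2 V → unitInterval)

omit [Fintype V] in
/-- The coordinates of `w` lie in `[0, 1]`. [folklore] -/
private theorem coeW_nonneg (e : Sym2 V) : 0 ≤ (w e : ℝ) := (w e).2.1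

omit [Fintype V] in
/-- The coordinates of `w` lie in `[0, 1]`. [folklore] -/
private theorem coeW_le_one (e : Sym2 V) : (w e : ℝ) ≤ 1 := (w e).2.2

/-- Arboreal-gas weights are nonnegative. [cite: Grimmett2006, §1.5 eq. (1.22) (p. 13)] -/
theorem agWeight_nonneg (ω : BondConfig V) : 0 ≤ agWeight w ω := by
  unfold agWeight
  split_ifs
  · exact weight_nonneg (coeW_nonneg w) (coeW_le_one w) ω
  · exact le_rfl

/-- Off forests the arboreal-gas weight vanishes. [cite: Grimmett2006, §1.5 eq. (1.22) (p. 13)] -/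
theorem agWeight_of_not_isForestCfg {ω : BondConfig V} (h : ¬ IsForestCfg ω) : agWeight w ω = 0 := by
  unfold agWeight; rw [if_neg h]

/-- On forests the arboreal-gas weight is the product weight. [cite: Grimmett2006, §1.5 eq. (1.22) (p. 13)] -/
theorem agWeight_of_isForestCfg {ω : BondConfig V} (h : IsForestCfg ω) : agWeight w ω = weight (fun e => (w e : ℝ)) ω := by
  unfold agWeight; rw [if_pos h]

/-- The partition function is nonnegative. [cite: Grimmett2006, §1.5 eq. (1.22) (p. 13)] -/
theorem agPartition_nonneg : 0 ≤ agPartition w := Finset.sum_nonneg fun ω _ => agWeight_nonneg w ω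

/-- Point masses are nonnegative. [cite: Grimmett2006, §1.5 eq. (1.22) (p. 13)] -/
theorem agMass_nonneg (ω : BondConfig V) : 0 ≤ agMass w ω := div_nonneg (agWeight_nonneg w ω) (agPartition_nonneg w)

/-- If no pair has parameter `1`, the empty forest has positive weight and `Z_for > 0`. [cite: Grimmett2006, §1.5 eq. (1.22) (p. 13)] -/
theorem agPartition_pos_of_lt_one (hw : ∀ e, (w e : ℝ) < 1) : 0 < agPartition w := by
  refine Finset.sum_pos' (fun ω _ => agWeight_nonneg w ω) ⟨∅, Finset.mem_univ _, ?_⟩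
  rw [agWeight_of_isForestCfg w isForestCfg_empty]
  unfold weight
  exact Finset.prod_pos fun e _ => by rw [if_neg (Set.notMem_empty e)]; linarith [hw e]

/-- **The arboreal-gas measure of an event as a finite sum** `μ(A) = Σ_ω agMass(ω)·1_A(ω)`. [cite: Grimmett2006, §1.5 eq. (1.22) (p. 13)] -/
theorem agMeasure_real_eq_sum (A : Set (BondConfig V)) :
    (agMeasure w).real A = ∑ ω : BondConfig V, agMass w ω * ind A ω := by
  have h1 : agMeasure w A = ∑ ω : BondConfig V, ENNReal.ofReal (agMass w ω * ind A ω) := by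
    simp only [agMeasure, Measure.coe_finsetSum, Measure.coe_smul, Finset.sum_apply, Pi.smul_apply, smul_eq_mul,
      Measure.dirac_apply, Set.indicator_apply, Pi.one_apply, mul_ite, mul_one, mul_zero]
    refine Finset.sum_congr rfl fun ω _ => ?_
    by_cases h : ω ∈ A
    · rw [if_pos h, ind_of_mem h, mul_one]
    · rw [if_neg h, ind_of_not_mem h, mul_zero, ENNReal.ofReal_zero]
  rw [measureReal_def, h1, ← ENNReal.ofReal_sum_of_nonneg fun ω _ => mul_nonneg (agMass_nonneg w ω) (ind_nonneg _ _),
    ENNReal.toReal_ofReal (Finset.sum_nonneg fun ω _ => mul_nonneg (agMass_nonneg w ω) (ind_nonneg _ _))]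

/-- Total mass: `μ(Ω) = 1` if `Z_for ≠ 0`, and `0` (junk) otherwise. [cite: Grimmett2006, §1.5 eq. (1.22) (p. 13)] -/
theorem agMeasure_real_univ : (agMeasure w).real univ = if agPartition w = 0 then 0 else 1 := by
  rw [agMeasure_real_eq_sum]
  simp only [ind_of_mem (Set.mem_univ _), mul_one]
  unfold agMass
  rw [← Finset.sum_div]
  change agPartition w / agPartition w = _
  split_ifs with h
  · rw [h, div_zero]
  · rw [div_self h]

/-- The arboreal gas is a finite measure. [cite: Grimmett2006, §1.5 eq. (1.22) (p. 13)] -/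
instance isFiniteMeasure_agMeasure : IsFiniteMeasure (agMeasure w) := by
  refine ⟨?_⟩
  simp only [agMeasure, Measure.coe_finsetSum, Measure.coe_smul, Finset.sum_apply, Pi.smul_apply, smul_eq_mul, measure_univ,
    mul_one]
  exact ENNReal.sum_lt_top.2 fun ω _ => ENNReal.ofReal_lt_top

omit [Fintype V] in
/-- The arboreal curve for `q > 0`, unclamped: `p_e(q) = w_e q/(1 − w_e + w_e q)`. [cite: Grimmett2006, §1.5 (pp. 13–14)] -/
theorem coe_agParams {q : ℝ} (hq : 0 < q) (e : Sym2 V) :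
    ((agParams w q e : unitInterval) : ℝ) = (w e : ℝ) * q / (1 - (w e : ℝ) + (w e : ℝ) * q) := by
  have h0 := coeW_nonneg w e
  have h1 := coeW_le_one w e
  have hden : 0 < 1 - (w e : ℝ) + (w e : ℝ) * q := by
    rcases h1.eq_or_lt with he | he
    · rw [he]; linarith
    · nlinarith
  have hr0 : 0 ≤ (w e : ℝ) * q / (1 - (w e : ℝ) + (w e : ℝ) * q) := div_nonneg (mul_nonneg h0 hq.le) hden.le
  have hr1 : (w e : ℝ) * q / (1 - (w e : ℝ) + (w e : ℝ) * q) ≤ 1 := by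
    rw [div_le_one hden]; linarith
  unfold agParams
  rw [Set.projIcc_of_mem zero_le_one ⟨hr0, hr1⟩]

omit [Fintype V] in
/-- On the arboreal curve, `1 − p_e(q) = (1 − w_e)/(1 − w_e + w_e q)`. [cite: Grimmett2006, §1.5 (pp. 13–14)] -/
theorem one_sub_coe_agParams {q : ℝ} (hq : 0 < q) (e : Sym2 V) :
    1 - ((agParams w q e : unitInterval) : ℝ) = (1 - (w e : ℝ)) / (1 - (w e : ℝ) + (w e : ℝ) * q) := by
  have h1 := coeW_le_one w e
  have hden : 0 < 1 - (w e : ℝ) + (w e : ℝ) * q := by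
    rcases h1.eq_or_lt with he | he
    · rw [he]; linarith
    · nlinarith [coeW_nonneg w e]
  rw [coe_agParams w hq]
  field_simp
  ring

/-! ### The node: Ayyer–Linusson–Ravichandran's Conjecture 7.1 -/

/-- **ALR Conjecture 7.1 — the hub inequality for the arboreal gas** ("Let `G = (V,E)` be a graph and `u, v, w ∈ V`.  Then
`μ^F_{G,λ}(u ↔ w, w ↔ v) ≥ μ^F_{G,λ}(u ↔ w)·μ^F_{G,λ}(w ↔ v)`"), stated for every finite weighted graph (edge parameters
`w : Sym2 (Fin n) → [0,1]`, hub `a`) in the homogeneous form `FK.HubUnder`.  CONJECTURE-SHAPED STATEMENT, NOT asserted; the printed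
conjecture is the case of constant activity on the edges of `G`.  Evidence: ALR verify it by computer on small graphs and prove the weaker
(13) on outerplanar graphs (their Thm. 5.3); fk-1 g7/g8's exact census of the random-cluster hub/cluster-association family down to the
arboreal regime found 0 violations.  The companion `…ArborealHub.lean` proves `FK.HubFKPos → ArborealHubPos` (limit `q ↓ 0` along the
arboreal curve) and the 2-tree case outright. [cite: AyyerLinussonRavichandran2025, §7 eq. (15), Conj. 7.1 (p. 22)] -/
@[conjecture] def ArborealHubPos : Prop :=
  ∀ (n : ℕ) (w : Sym2 (Fin n) → unitInterval) (u a v : Fin n), HubUnder (agMeasure w) u a v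

end FK

end Summit.CriticalPhenomena.PercolationContinuityZ3.Theorems

end
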